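import Literature.Geometry.Lorentzian.InverseMeanCurvatureFlowWeakGradient
import Literature.Geometry.Lorentzian.InverseMeanCurvatureFlowCalibration
import HarnessLib

/-!
# Inverse mean curvature flow I — proofs: lower semicontinuity of the weighted slope integral
# `∫ w |∇u|_h dμ_h` on a Riemannian `3`-manifold

The manifold form of the lower semicontinuity engine of
`InverseMeanCurvatureFlowWeakGradient.lean`, i.e. the step "it follows by lower semicontinuity
that `∫ φ|∇u|(1 + u − v) ≤ ∫ φ|∇v|`" in the proof of Huisken–Ilmanen's **Compactness
Theorem 2.1** (J. Differential Geom. 59 (2001), §2, p. 21–22), for the level-set weak formulation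
of `InverseMeanCurvatureFlow.lean` (`gradNorm`, `IsLocLipschitzOn`, the Riemannian measure
`riemannianMeasure h`):

* `isLocLipschitzOn_of_contMDiff` — **`C¹` functions are locally Lipschitz for the Riemannian
  distance** (charts are locally bi-Lipschitz for the length distance,
  `exists_nhds_riemannianEDist_le_and_edist_le` of `VolumeChartFormula.lean`); in particular the
  smooth cutoffs of the proof of Thm. 2.1 are admissible in competitors;
* `exists_nhds_forall_lipschitzOnWith_chart` — **uniform transfer of Lipschitz bounds to a
  chart**: near every point there are a chart neighbourhood `U` and a constant `c` such that every
  function `K`-Lipschitz (Riemannian distance) on `V ⊆ U` has a `Kc`-Lipschitz chart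
  representative on `φ(V)` — equi-Lipschitz families stay equi-Lipschitz in charts;
* `posDef_gram_localFrame` — the Gram matrix of a coordinate frame is positive definite;
* `integral_mul_gradNorm_eq_integral_chart` — **the weighted slope integral in a chart**:
  `∫ w |∇u|_h dμ_h = ∫ W(y) √(∑ₖₗ hᵏˡ ∂ₖû ∂ₗû)(y) dy` with `W = 1_T (w ∘ φ⁻¹) √det(h_{ij})`
  (`gradNorm_sq_eq_sum_chart`, `setIntegral_extChartAt_comp`);
* `integral_mul_gradNorm_le_of_tendsto_chart`, `integral_mul_gradNorm_le_of_tendstoLocallyUniformlyOn`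
  — **lower semicontinuity of `u ↦ ∫ w |∇u|_h dμ_h`** along sequences `uᵢ → u` converging
  locally uniformly with locally uniform Lipschitz bounds on an open set `Ω ⊇ tsupport w`
  (`w ≥ 0` continuous with compact support): for every `ε > 0`, eventually
  `∫ w |∇u| dμ_h ≤ ∫ w |∇uᵢ| dμ_h + ε`. Locally this is the Euclidean engine
  (`integral_mul_sqrt_le_of_tendstoLocallyUniformlyOn`) applied to McShane extensions of the
  chart representatives; globally, a smooth partition of unity on `tsupport w` subordinate to
  such chart neighbourhoods.

Everything is proved; there are no definitions and no named facts. Theorem 2.1 itself is in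
`InverseMeanCurvatureFlowCompactness.lean`.

## References

* G. Huisken, T. Ilmanen, *The inverse mean curvature flow and the Riemannian Penrose
  inequality*, J. Differential Geom. 59 (2001) 353–437: §2, Compactness Theorem 2.1 and its proof.
* E. Giusti, *Minimal surfaces and functions of bounded variation*, Birkhäuser 1984, Thm. 1.9.
* D. Burago, Yu. Burago, S. Ivanov, *A course in metric geometry*, AMS 2001, §5.1 (charts are
  locally bi-Lipschitz for the length metric).
-/

noncomputable section

open Bundle Set Manifold TopologicalSpace Filter MeasureTheory Function
open scoped ContDiff Topology ENNReal NNReal Manifold Real Matrix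

namespace Literature.Geometry.Lorentzian

open PseudoRiemannianMetric

variable {X : Type*} [TopologicalSpace X] [ChartedSpace E3 X] [IsManifold (𝓡 3) ∞ X]

/-! ### `C¹` functions are locally Lipschitz for the Riemannian distance -/

section SmoothLipschitz

variable (h : ContMDiffRiemannianMetric (𝓡 3) ∞ E3 (TangentSpace (𝓡 3) : X → Type _))
  [T2Space X] [LocallyCompactSpace X]

set_option backward.isDefEq.respectTransparency false in
/-- **`C¹` functions are locally Lipschitz for the Riemannian distance.** If `f : X → ℝ` is `C¹`
then `f` is locally Lipschitz on `X` for the length distance of `h`: in the chart `φ` at `p` the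
representative `f ∘ φ⁻¹` is `C¹`, hence Lipschitz near `φ p` (mean value inequality, Mathlib's
`ContDiffAt.exists_lipschitzOnWith`), and `φ` is Lipschitz near `p` from the length distance to the
chart (`exists_nhds_riemannianEDist_le_and_edist_le`, through an invertible linearization `A`,
Burago–Burago–Ivanov 2001, §5.1). In particular the smooth cutoff functions of Huisken–Ilmanen's
proof of Thm. 2.1 yield locally Lipschitz competitors `φ v + (1 − φ) uᵢ`.
[cite: HuiskenIlmanenIMCF2001, §2 proof of Thm. 2.1] -/
theorem isLocLipschitzOn_of_contMDiff {f : X → ℝ} (hf : ContMDiff (𝓡 3) 𝓘(ℝ, ℝ) 1 f) :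
    IsLocLipschitzOn h f univ := by
  letI : RiemannianBundle (fun x : X ↦ TangentSpace (𝓡 3) x) :=
    ⟨h.toContinuousRiemannianMetric.toRiemannianMetric⟩
  letI : PseudoEMetricSpace X := .ofRiemannianMetric (𝓡 3) X
  change LocallyLipschitzOn univ f
  intro p _
  set φ := extChartAt (𝓡 3) p with hφ
  -- `f ∘ φ⁻¹` is `C¹` at `φ p`, hence Lipschitz on a neighbourhood `t` of `φ p`
  have hsymm : ContMDiffAt 𝓘(ℝ, E3) (𝓡 3) 1 φ.symm (φ p) :=
    ((contMDiffOn_extChartAt_symm (n := ∞) p).contMDiffAt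
      ((isOpen_extChartAt_target p).mem_nhds (mem_extChartAt_target p))).of_le
      (by exact_mod_cast le_top)
  have hcomp : ContMDiffAt 𝓘(ℝ, E3) 𝓘(ℝ, ℝ) 1 (f ∘ φ.symm) (φ p) := by
    have hfp : ContMDiffAt (𝓡 3) 𝓘(ℝ, ℝ) 1 f (φ.symm (φ p)) := hf.contMDiffAt
    exact hfp.comp (φ p) hsymm
  obtain ⟨L, t, ht, hL⟩ := (contMDiffAt_iff_contDiffAt.1 hcomp).exists_lipschitzOnWith
  -- the chart is Lipschitz near `p` from the length distance, via an invertible linearization `A`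
  obtain ⟨A, hA⟩ := exists_norm_eq_norm_symmL (I := 𝓡 3) p p
  obtain ⟨Ae, hAe⟩ := exists_continuousLinearEquiv_of_norm_eq_norm_symmL (I := 𝓡 3) p p
    (mem_chart_source E3 p) hA
  obtain ⟨U, hU, hUsrc, -, hge⟩ :=
    exists_nhds_riemannianEDist_le_and_edist_le (I := 𝓡 3) p p (mem_chart_source E3 p) hA
      one_lt_two
  have hsrc : U ⊆ φ.source := by rw [hφ, extChartAt_source]; exact hUsrc
  -- the neighbourhood `U ∩ φ⁻¹ t`
  have htp : φ ⁻¹' t ∈ 𝓝 p := (continuousAt_extChartAt p).preimage_mem_nhds ht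
  refine ⟨L * (‖(Ae.symm : E3 →L[ℝ] E3)‖₊ * 2), U ∩ φ ⁻¹' t,
    mem_nhdsWithin_of_mem_nhds (inter_mem hU htp), ?_⟩
  intro q hq q' hq'
  have hq1 : f q = (f ∘ φ.symm) (φ q) := by
    simp only [Function.comp_apply, φ.left_inv (hsrc hq.1)]
  have hq'1 : f q' = (f ∘ φ.symm) (φ q') := by
    simp only [Function.comp_apply, φ.left_inv (hsrc hq'.1)]
  have hAq : ∀ z : E3, z = Ae.symm (A z) := fun z ↦ by
    rw [← hAe z, ContinuousLinearEquiv.symm_apply_apply]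
  calc edist (f q) (f q') = edist ((f ∘ φ.symm) (φ q)) ((f ∘ φ.symm) (φ q')) := by rw [hq1, hq'1]
    _ ≤ L * edist (φ q) (φ q') := hL hq.2 hq'.2
    _ = L * edist (Ae.symm (A (φ q))) (Ae.symm (A (φ q'))) := by rw [← hAq, ← hAq]
    _ ≤ L * (‖(Ae.symm : E3 →L[ℝ] E3)‖₊ * edist (A (φ q)) (A (φ q'))) := by
        gcongr
        exact (Ae.symm : E3 →L[ℝ] E3).lipschitz.edist_le_mul _ _
    _ ≤ L * (‖(Ae.symm : E3 →L[ℝ] E3)‖₊ * ((2 : ℝ≥0) * riemannianEDist (𝓡 3) q q')) := by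
        gcongr
        exact hge q hq.1 q' hq'.1
    _ = (L * (‖(Ae.symm : E3 →L[ℝ] E3)‖₊ * 2) : ℝ≥0) * edist q q' := by
        rw [show edist q q' = riemannianEDist (𝓡 3) q q' from rfl]
        push_cast
        ring

/-- A `C¹` function is locally Lipschitz (Riemannian distance) on every set. [folklore] -/
theorem isLocLipschitzOn_of_contMDiff' {f : X → ℝ} (hf : ContMDiff (𝓡 3) 𝓘(ℝ, ℝ) 1 f)
    (Ω : Set X) :
    IsLocLipschitzOn h f Ω :=
  (isLocLipschitzOn_of_contMDiff h hf).mono h (subset_univ Ω)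

end SmoothLipschitz

/-! ### Uniform transfer of Lipschitz bounds to a chart -/

section ChartTransfer

variable (h : ContMDiffRiemannianMetric (𝓡 3) ∞ E3 (TangentSpace (𝓡 3) : X → Type _))
  [T2Space X] [LocallyCompactSpace X]

set_option backward.isDefEq.respectTransparency false in
/-- **Equi-Lipschitz families stay equi-Lipschitz in charts.** Every point `p` has an open
neighbourhood `U` inside the domain of the chart `φ` at `p` and a constant `c` such that for every
`V ⊆ U`, every function `K`-Lipschitz on `V` for the Riemannian distance has a `(K c)`-Lipschitz
representative `w ∘ φ⁻¹` on `φ(V)` (Euclidean distance): `d_h(q, q') ≤ 2 ‖A(φ q) − A(φ q')‖`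
near `p` (`exists_nhds_riemannianEDist_le_and_edist_le`). The constant does not depend on `w`,
which is what the uniform Lipschitz bounds `sup_K |∇uᵢ| ≤ C(K)` of Huisken–Ilmanen's Thm. 2.1
require. [cite: HuiskenIlmanenIMCF2001, §2 Thm. 2.1 (hypotheses)] -/
theorem exists_nhds_forall_lipschitzOnWith_chart (p : X) :
    letI : RiemannianBundle (fun x : X ↦ TangentSpace (𝓡 3) x) :=
      ⟨h.toContinuousRiemannianMetric.toRiemannianMetric⟩
    letI : PseudoEMetricSpace X := .ofRiemannianMetric (𝓡 3) X
    ∃ U : Set X, IsOpen U ∧ p ∈ U ∧ U ⊆ (extChartAt (𝓡 3) p).source ∧ ∃ c : ℝ≥0,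
      ∀ (w : X → ℝ) (K : ℝ≥0) (V : Set X), V ⊆ U → LipschitzOnWith K w V →
        LipschitzOnWith (K * c) (w ∘ (extChartAt (𝓡 3) p).symm) (extChartAt (𝓡 3) p '' V) := by
  letI : RiemannianBundle (fun x : X ↦ TangentSpace (𝓡 3) x) :=
    ⟨h.toContinuousRiemannianMetric.toRiemannianMetric⟩
  letI : PseudoEMetricSpace X := .ofRiemannianMetric (𝓡 3) X
  obtain ⟨A, hA⟩ := exists_norm_eq_norm_symmL (I := 𝓡 3) p p
  obtain ⟨U₁, hU₁, hU₁src, hle, -⟩ := exists_nhds_riemannianEDist_le_and_edist_le (I := 𝓡 3) p p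
    (mem_chart_source E3 p) hA one_lt_two
  have hsrc : interior U₁ ⊆ (extChartAt (𝓡 3) p).source := by
    rw [extChartAt_source]; exact interior_subset.trans hU₁src
  refine ⟨interior U₁, isOpen_interior, mem_interior_iff_mem_nhds.2 hU₁, hsrc, 2 * ‖A‖₊, ?_⟩
  intro w K V hVU hw
  rintro _ ⟨q, hq, rfl⟩ _ ⟨q', hq', rfl⟩
  have hqU := interior_subset (hVU hq)
  have hq'U := interior_subset (hVU hq')
  simp only [Function.comp_apply, (extChartAt (𝓡 3) p).left_inv (hsrc (hVU hq)),
    (extChartAt (𝓡 3) p).left_inv (hsrc (hVU hq'))]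
  calc edist (w q) (w q') ≤ K * edist q q' := hw hq hq'
    _ ≤ K * ((2 : ℝ≥0) * edist (A (extChartAt (𝓡 3) p q)) (A (extChartAt (𝓡 3) p q'))) := by
      gcongr
      exact hle q hqU q' hq'U
    _ ≤ K * ((2 : ℝ≥0) * (‖A‖₊ * edist (extChartAt (𝓡 3) p q) (extChartAt (𝓡 3) p q'))) := by
      gcongr
      exact A.lipschitz.edist_le_mul _ _
    _ = (K * (2 * ‖A‖₊) : ℝ≥0) * edist (extChartAt (𝓡 3) p q) (extChartAt (𝓡 3) p q') := by
      push_cast; ring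

omit [IsManifold (𝓡 3) ∞ X] [T2Space X] [LocallyCompactSpace X] in
/-- The chart image of an open subset of the chart domain is open. [folklore] -/
theorem isOpen_image_extChartAt {p : X} {V : Set X} (hV : IsOpen V)
    (hVs : V ⊆ (extChartAt (𝓡 3) p).source) : IsOpen (extChartAt (𝓡 3) p '' V) := by
  rw [(extChartAt (𝓡 3) p).image_eq_target_inter_inv_preimage hVs]
  exact (continuousOn_extChartAt_symm p).isOpen_inter_preimage (isOpen_extChartAt_target p) hV

omit [IsManifold (𝓡 3) ∞ X] [T2Space X] [LocallyCompactSpace X] in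
/-- **Locally uniform convergence is read in charts.** If `uᵢ → U` locally uniformly on the open
set `Ω` and `V ⊆ Ω` is an open subset of the domain of the chart `φ` at `p`, then
`uᵢ ∘ φ⁻¹ → U ∘ φ⁻¹` locally uniformly on `φ(V)`. [folklore] -/
theorem tendstoLocallyUniformlyOn_comp_extChartAt_symm {u : ℕ → X → ℝ} {U : X → ℝ}
    {Ω V : Set X} (hconv : TendstoLocallyUniformlyOn u U atTop Ω) {p : X} (hVΩ : V ⊆ Ω)
    (hVs : V ⊆ (extChartAt (𝓡 3) p).source) :
    TendstoLocallyUniformlyOn (fun i ↦ u i ∘ (extChartAt (𝓡 3) p).symm)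
      (U ∘ (extChartAt (𝓡 3) p).symm) atTop (extChartAt (𝓡 3) p '' V) := by
  refine (hconv.mono hVΩ).comp (extChartAt (𝓡 3) p).symm ?_ ?_
  · rintro _ ⟨q, hq, rfl⟩
    rwa [(extChartAt (𝓡 3) p).left_inv (hVs hq)]
  · exact (continuousOn_extChartAt_symm p).mono (by
      rintro _ ⟨q, hq, rfl⟩
      exact (extChartAt (𝓡 3) p).map_source (hVs hq))

end ChartTransfer

/-! ### The weighted slope integral read in a chart -/

section ChartFormula

variable (h : ContMDiffRiemannianMetric (𝓡 3) ∞ E3 (TangentSpace (𝓡 3) : X → Type _))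

/-- **The Gram matrix of a coordinate frame is positive definite** (it is the Gram matrix of a
basis under a Riemannian metric). [folklore] -/
theorem posDef_gram_localFrame {ι : Type*} [Fintype ι] [DecidableEq ι] (b : Module.Basis ι ℝ E3)
    {x₀ q : X} (hq : q ∈ (chartAt E3 x₀).source) :
    (Matrix.of fun i j ↦ (ofRiemannian h).val q
      ((trivializationAt E3 (TangentSpace (𝓡 3)) x₀).localFrame b i q)
      ((trivializationAt E3 (TangentSpace (𝓡 3)) x₀).localFrame b j q)).PosDef := by
  have hqe : q ∈ (trivializationAt E3 (TangentSpace (𝓡 3)) x₀).baseSet := by simpa using hq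
  set β := (trivializationAt E3 (TangentSpace (𝓡 3)) x₀).basisAt b hqe with hβ
  have hFr : ∀ i, (trivializationAt E3 (TangentSpace (𝓡 3)) x₀).localFrame b i q = β i := fun i ↦
    Trivialization.localFrame_apply_of_mem_baseSet _ b hqe
  refine Matrix.PosDef.of_dotProduct_mulVec_pos ?_ fun v hv ↦ ?_
  · ext i j
    simp only [Matrix.conjTranspose_apply, star_trivial, Matrix.of_apply]
    exact (ofRiemannian h).symm q _ _
  · have hq' : star v ⬝ᵥ ((Matrix.of fun i j ↦ (ofRiemannian h).val q
        ((trivializationAt E3 (TangentSpace (𝓡 3)) x₀).localFrame b i q)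
        ((trivializationAt E3 (TangentSpace (𝓡 3)) x₀).localFrame b j q)) *ᵥ v) =
        (ofRiemannian h).val q (∑ i, v i • β i) (∑ j, v j • β j) := by
      rw [star_trivial, ← sum_sum_mul_mul_eq_dotProduct_mulVec]
      simp only [Matrix.of_apply, hFr, map_sum, map_smul, FunLike.coe_sum, FunLike.coe_smul,
        Finset.sum_apply, Pi.smul_apply, smul_eq_mul, Finset.mul_sum]
      rw [Finset.sum_comm]
      refine Finset.sum_congr rfl fun k _ ↦ Finset.sum_congr rfl fun l _ ↦ ?_
      rw [(ofRiemannian h).symm q (β l) (β k)]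
      ring
    rw [hq']
    refine isRiemannian_ofRiemannian h _ _ fun h0 ↦ hv ?_
    funext i
    exact Fintype.linearIndependent_iff.1 β.linearIndependent v h0 i

/-- **The inverse metric coefficients composed with the inverse chart are continuous on the chart
target.** [folklore] -/
theorem continuousOn_gram_localFrame_inv_comp_symm {ι : Type*} [Fintype ι] [DecidableEq ι]
    (b : Module.Basis ι ℝ E3) (p : X) (k l : ι) :
    ContinuousOn (fun y ↦ (Matrix.of fun i j ↦ (ofRiemannian h).val ((extChartAt (𝓡 3) p).symm y)
      ((trivializationAt E3 (TangentSpace (𝓡 3)) p).localFrame b i ((extChartAt (𝓡 3) p).symm y))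
      ((trivializationAt E3 (TangentSpace (𝓡 3)) p).localFrame b j
        ((extChartAt (𝓡 3) p).symm y)))⁻¹ k l) (extChartAt (𝓡 3) p).target := by
  have hc : ContinuousOn (fun q ↦ (Matrix.of fun i j ↦ (ofRiemannian h).val q
      ((trivializationAt E3 (TangentSpace (𝓡 3)) p).localFrame b i q)
      ((trivializationAt E3 (TangentSpace (𝓡 3)) p).localFrame b j q))⁻¹ k l)
      (trivializationAt E3 (TangentSpace (𝓡 3)) p).baseSet :=
    (contMDiffOn_gram_localFrame_inv (trivializationAt E3 (TangentSpace (𝓡 3)) p)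
      (ofRiemannian h) b k l).continuousOn
  rw [TangentBundle.trivializationAt_baseSet] at hc
  refine hc.comp (continuousOn_extChartAt_symm p) fun y hy ↦ ?_
  rw [← extChartAt_source (𝓡 3)]
  exact (extChartAt (𝓡 3) p).map_target hy

variable [T2Space X] [LocallyCompactSpace X] [MeasurableSpace X] [BorelSpace X]

set_option backward.isDefEq.respectTransparency false in
/-- **The weighted slope integral in a chart.** For `w` continuous with `tsupport w` inside the
domain of the chart `φ` at `p`, and any `u : X → ℝ`,
`∫ w |∇u|_h dμ_h = ∫ W(y) √(∑ₗ ∑ₖ Nₖₗ(y) ∂ₖû(y) ∂ₗû(y)) dy`, where `û = u ∘ φ⁻¹`,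
`N ∘ φ = (hᵏˡ)` is the inverse metric in the coordinate frame (any coefficient field `N` on `ℝ³`,
continuous on the chart target, which pulls back to `hᵏˡ` on the chart domain) and
`W = 1_{φ.target} · (w ∘ φ⁻¹) √det(h_{ij})` (the slope in the chart, `gradNorm_sq_eq_sum_chart`,
O'Neill 1983, p. 60; the Riemannian measure in the chart, `setIntegral_extChartAt_comp`,
Chavel 2006, (III.3.6)). This identifies Huisken–Ilmanen's `∫ φ|∇u|` with an anisotropic weighted
total variation on `ℝ³`. [cite: HuiskenIlmanenIMCF2001, §2 proof of Thm. 2.1] -/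
theorem integral_mul_gradNorm_eq_integral_chart {ι : Type*} [Fintype ι] [DecidableEq ι]
    (b : Module.Basis ι ℝ E3) (p : X) {N : E3 → Matrix ι ι ℝ}
    (hN : ∀ x ∈ (extChartAt (𝓡 3) p).source, ∀ k l, N (extChartAt (𝓡 3) p x) k l =
      (Matrix.of fun i j ↦ (ofRiemannian h).val x
        ((trivializationAt E3 (TangentSpace (𝓡 3)) p).localFrame b i x)
        ((trivializationAt E3 (TangentSpace (𝓡 3)) p).localFrame b j x))⁻¹ k l)
    (hNc : ∀ k l, ContinuousOn (fun y ↦ N y k l) (extChartAt (𝓡 3) p).target)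
    {w : X → ℝ} (hw : Continuous w) (hws : tsupport w ⊆ (extChartAt (𝓡 3) p).source) (u : X → ℝ) :
    ∫ x, w x * gradNorm h u x ∂riemannianMeasure h =
      ∫ y, (extChartAt (𝓡 3) p).target.indicator
          (fun y ↦ w ((extChartAt (𝓡 3) p).symm y) * Real.sqrt (chartGramMatrix h p y).det) y *
        Real.sqrt (∑ l, ∑ k, N y k l * fderiv ℝ (u ∘ (extChartAt (𝓡 3) p).symm) y (b k) *
          fderiv ℝ (u ∘ (extChartAt (𝓡 3) p).symm) y (b l)) := by
  have hsrc : (extChartAt (𝓡 3) p).source = (chartAt E3 p).source := extChartAt_source (𝓡 3) p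
  -- step 1: the integrand vanishes off the chart domain
  have h1 : ∫ x, w x * gradNorm h u x ∂riemannianMeasure h =
      ∫ x in (extChartAt (𝓡 3) p).source, w x * gradNorm h u x ∂riemannianMeasure h :=
    (setIntegral_eq_integral_of_forall_compl_eq_zero (fun x hx ↦ by
      rw [image_eq_zero_of_notMem_tsupport (fun hx' ↦ hx (hws hx')), zero_mul])).symm
  -- step 2: on the chart domain the integrand is `g ∘ φ`
  set g : E3 → ℝ := fun y ↦ w ((extChartAt (𝓡 3) p).symm y) * Real.sqrt (∑ l, ∑ k, N y k l *
    fderiv ℝ (u ∘ (extChartAt (𝓡 3) p).symm) y (b k) *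
    fderiv ℝ (u ∘ (extChartAt (𝓡 3) p).symm) y (b l)) with hg
  have h2 : ∫ x in (extChartAt (𝓡 3) p).source, w x * gradNorm h u x ∂riemannianMeasure h =
      ∫ x in (extChartAt (𝓡 3) p).source, g (extChartAt (𝓡 3) p x) ∂riemannianMeasure h := by
    refine setIntegral_congr_fun (isOpen_extChartAt_source p).measurableSet fun x hx ↦ ?_
    have hx' : x ∈ (chartAt E3 p).source := hsrc ▸ hx
    have hgx : gradNorm h u x = Real.sqrt (∑ l, ∑ k, N (extChartAt (𝓡 3) p x) k l *
        fderiv ℝ (u ∘ (extChartAt (𝓡 3) p).symm) (extChartAt (𝓡 3) p x) (b k) *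
        fderiv ℝ (u ∘ (extChartAt (𝓡 3) p).symm) (extChartAt (𝓡 3) p x) (b l)) := by
      rw [← Real.sqrt_sq (gradNorm_nonneg h u x), gradNorm_sq_eq_sum_chart h b (u := u) hx']
      congr 1
      refine Finset.sum_congr rfl fun l _ ↦ Finset.sum_congr rfl fun k _ ↦ ?_
      rw [hN x hx k l]
    simp only [hg, (extChartAt (𝓡 3) p).left_inv hx, hgx]
  -- step 3: change of variables to the chart
  have hgm : AEStronglyMeasurable g ((volume : Measure E3).restrict (extChartAt (𝓡 3) p).target) := by
    refine (AEMeasurable.mul ?_ (Real.continuous_sqrt.measurable.comp_aemeasurable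
      (aemeasurable_restrict_sum_sum_mul_fderiv (μ := volume) (measurableSet_extChartAt_target p)
        hNc b (u ∘ (extChartAt (𝓡 3) p).symm) (u ∘ (extChartAt (𝓡 3) p).symm)))).aestronglyMeasurable
    exact (hw.comp_continuousOn (continuousOn_extChartAt_symm p)).aemeasurable
      (measurableSet_extChartAt_target p)
  have h3 := setIntegral_extChartAt_comp h p hgm
  rw [h1, h2, h3, ← integral_indicator (measurableSet_extChartAt_target p)]
  refine integral_congr_ae (Eventually.of_forall fun y ↦ ?_)
  dsimp only
  by_cases hy : y ∈ (extChartAt (𝓡 3) p).target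
  · rw [indicator_of_mem hy, indicator_of_mem hy, smul_eq_mul]
    ring
  · rw [indicator_of_notMem hy, indicator_of_notMem hy, zero_mul]

end ChartFormula

/-! ### Lower semicontinuity of the weighted slope integral, chart-local form -/

section ChartLSC

variable (h : ContMDiffRiemannianMetric (𝓡 3) ∞ E3 (TangentSpace (𝓡 3) : X → Type _))
  [T2Space X] [LocallyCompactSpace X] [MeasurableSpace X] [BorelSpace X]

set_option backward.isDefEq.respectTransparency false in
/-- **Lower semicontinuity of `∫ w|∇u| dμ_h`, chart-local form.** Let `Uc` be a chart
neighbourhood of `p` with transfer constant `c` (`exists_nhds_forall_lipschitzOnWith_chart`),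
`V ⊆ Uc` open, `uᵢ, u` all `K`-Lipschitz on `V` (Riemannian distance) with `uᵢ → u` locally
uniformly on `V`, and `w ≥ 0` continuous with compact support inside `V`. Then for every `ε > 0`,
eventually `∫ w |∇u| dμ_h ≤ ∫ w |∇uᵢ| dμ_h + ε`. Proof: read everything in the chart
(`integral_mul_gradNorm_eq_integral_chart`), extend the equi-Lipschitz representatives to `ℝ³`
(McShane, `LipschitzOnWith.extend_real`) and apply the Euclidean engine
`integral_mul_sqrt_le_of_tendstoLocallyUniformlyOn`. Huisken–Ilmanen, proof of Thm. 2.1: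
"it follows by lower semicontinuity". [cite: HuiskenIlmanenIMCF2001, §2 proof of Thm. 2.1] -/
theorem integral_mul_gradNorm_le_of_tendsto_chart (p : X) {Uc : Set X} {c : ℝ≥0}
    (hUs : Uc ⊆ (extChartAt (𝓡 3) p).source)
    (hUc : letI : RiemannianBundle (fun x : X ↦ TangentSpace (𝓡 3) x) :=
        ⟨h.toContinuousRiemannianMetric.toRiemannianMetric⟩
      letI : PseudoEMetricSpace X := .ofRiemannianMetric (𝓡 3) X
      ∀ (w : X → ℝ) (K : ℝ≥0) (V : Set X), V ⊆ Uc → LipschitzOnWith K w V →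
        LipschitzOnWith (K * c) (w ∘ (extChartAt (𝓡 3) p).symm) (extChartAt (𝓡 3) p '' V))
    {u : ℕ → X → ℝ} {U : X → ℝ} {V : Set X} (hV : IsOpen V) (hVU : V ⊆ Uc) {K : ℝ≥0}
    (hlip : letI : RiemannianBundle (fun x : X ↦ TangentSpace (𝓡 3) x) :=
        ⟨h.toContinuousRiemannianMetric.toRiemannianMetric⟩
      letI : PseudoEMetricSpace X := .ofRiemannianMetric (𝓡 3) X
      (∀ i, LipschitzOnWith K (u i) V) ∧ LipschitzOnWith K U V)
    (hconv : TendstoLocallyUniformlyOn u U atTop V)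
    {w : X → ℝ} (hw : Continuous w) (hw0 : ∀ x, 0 ≤ w x) (hwc : HasCompactSupport w)
    (hwV : tsupport w ⊆ V) {ε : ℝ} (hε : 0 < ε) :
    ∀ᶠ i in atTop, ∫ x, w x * gradNorm h U x ∂riemannianMeasure h ≤
      (∫ x, w x * gradNorm h (u i) x ∂riemannianMeasure h) + ε := by
  letI : RiemannianBundle (fun x : X ↦ TangentSpace (𝓡 3) x) :=
    ⟨h.toContinuousRiemannianMetric.toRiemannianMetric⟩
  letI : PseudoEMetricSpace X := .ofRiemannianMetric (𝓡 3) X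
  classical
  set φ := extChartAt (𝓡 3) p with hφ
  set b : Module.Basis (Fin 3) ℝ E3 := (EuclideanSpace.basisFun (Fin 3) ℝ).toBasis with hb
  set N : E3 → Matrix (Fin 3) (Fin 3) ℝ := fun y ↦ (Matrix.of fun i j ↦
    (ofRiemannian h).val (φ.symm y)
      ((trivializationAt E3 (TangentSpace (𝓡 3)) p).localFrame b i (φ.symm y))
      ((trivializationAt E3 (TangentSpace (𝓡 3)) p).localFrame b j (φ.symm y)))⁻¹ with hNdef
  -- chart-side sets: `S = φ(V)` open, `K' = φ(tsupport w)` compact, `K' ⊆ S ⊆ φ.target`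
  set S := φ '' V with hS
  have hVs : V ⊆ φ.source := hVU.trans hUs
  have hSo : IsOpen S := isOpen_image_extChartAt hV hVs
  have hSt : S ⊆ φ.target := by
    rintro _ ⟨q, hq, rfl⟩; exact φ.map_source (hVs hq)
  set K' := φ '' tsupport w with hK'
  have hK'c : IsCompact K' :=
    hwc.image_of_continuousOn ((continuousOn_extChartAt p).mono (hwV.trans hVs))
  have hK'S : K' ⊆ S := image_mono hwV
  -- equi-Lipschitz chart representatives and their McShane extensions
  have hL : ∀ i, LipschitzOnWith (K * c) (u i ∘ φ.symm) S := fun i ↦ hUc _ _ _ hVU (hlip.1 i)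
  have hLU : LipschitzOnWith (K * c) (U ∘ φ.symm) S := hUc _ _ _ hVU hlip.2
  choose F hF hFeq using fun i ↦ (hL i).extend_real
  obtain ⟨G, hG, hGeq⟩ := hLU.extend_real
  have hconvS : TendstoLocallyUniformlyOn F G atTop S :=
    ((tendstoLocallyUniformlyOn_comp_extChartAt_symm hconv subset_rfl hVs).congr
      (fun i ↦ hFeq i)).congr_right hGeq
  -- the coefficients are continuous and positive semidefinite on the target
  have hNc : ∀ k l, ContinuousOn (fun y ↦ N y k l) φ.target := fun k l ↦
    continuousOn_gram_localFrame_inv_comp_symm h b p k l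
  have hNpsd : ∀ y ∈ φ.target, (N y).PosSemidef := by
    intro y hy
    have hq : φ.symm y ∈ (chartAt E3 p).source := by
      rw [← extChartAt_source (𝓡 3)]; exact φ.map_target hy
    exact (posDef_gram_localFrame h b hq).inv.posSemidef
  -- the weight `W = 1_target (w ∘ φ⁻¹) √det h`
  set ρ : E3 → ℝ := fun y ↦ Real.sqrt (chartGramMatrix h p y).det with hρ
  set W : E3 → ℝ := φ.target.indicator (fun y ↦ w (φ.symm y) * ρ y) with hW
  have hW0 : ∀ y, 0 ≤ W y := fun y ↦
    indicator_nonneg (fun y _ ↦ mul_nonneg (hw0 _) (Real.sqrt_nonneg _)) y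
  have hWK : ∀ y ∉ K', W y = 0 := by
    intro y hy
    by_cases hyt : y ∈ φ.target
    · rw [hW, indicator_of_mem hyt]
      have : w (φ.symm y) = 0 :=
        image_eq_zero_of_notMem_tsupport fun hmem ↦ hy ⟨φ.symm y, hmem, φ.right_inv hyt⟩
      rw [this, zero_mul]
    · rw [hW, indicator_of_notMem hyt]
  obtain ⟨Bw, hBw⟩ := hw.bddAbove_range_of_hasCompactSupport hwc
  have hBw' : ∀ x, w x ≤ Bw := fun x ↦ hBw (mem_range_self x)
  obtain ⟨Bρ, hBρ⟩ := hK'c.exists_bound_of_continuousOn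
    ((continuousOn_sqrt_det_chartGramMatrix h p).mono (hK'S.trans hSt))
  have hWb : ∀ y, W y ≤ max (Bw * Bρ) 0 := by
    intro y
    by_cases hy : y ∈ K'
    · rw [hW, indicator_of_mem (hSt (hK'S hy))]
      refine (le_max_left _ _).trans' ?_
      have h1 : ρ y ≤ Bρ := (le_abs_self _).trans (by simpa [Real.norm_eq_abs] using hBρ y hy)
      exact mul_le_mul (hBw' (φ.symm y)) h1 (Real.sqrt_nonneg _)
        ((hw0 (φ.symm y)).trans (hBw' (φ.symm y)))
    · rw [hWK y hy]; exact le_max_right _ _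
  have hWm : AEMeasurable W ((volume : Measure E3).restrict K') := by
    have hcont : ContinuousOn (fun y ↦ w (φ.symm y) * ρ y) K' :=
      ((hw.comp_continuousOn (continuousOn_extChartAt_symm p)).mono (hK'S.trans hSt)).mul
        ((continuousOn_sqrt_det_chartGramMatrix h p).mono (hK'S.trans hSt))
    exact (hcont.congr (fun y hy ↦ by rw [hW, indicator_of_mem (hSt (hK'S hy))])).aemeasurable
      hK'c.measurableSet
  -- the Euclidean engine
  have hmain := integral_mul_sqrt_le_of_tendstoLocallyUniformlyOn (μ := (volume : Measure E3))
    (⇑b) hSo hK'c hK'S (fun k l ↦ (hNc k l).mono hSt) (fun y hy ↦ hNpsd y (hSt hy)) hF hG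
    hconvS hWm hW0 hWb hWK hε
  -- both sides are the chart integrals of the weighted slopes
  have hNpull : ∀ x ∈ φ.source, ∀ k l, N (φ x) k l =
      (Matrix.of fun i j ↦ (ofRiemannian h).val x
        ((trivializationAt E3 (TangentSpace (𝓡 3)) p).localFrame b i x)
        ((trivializationAt E3 (TangentSpace (𝓡 3)) p).localFrame b j x))⁻¹ k l := by
    intro x hx k l
    simp only [hNdef]
    rw [φ.left_inv hx]
  have hchart : ∀ v : X → ℝ, ∫ x, w x * gradNorm h v x ∂riemannianMeasure h =
      ∫ y, W y * Real.sqrt (∑ l, ∑ k, N y k l * fderiv ℝ (v ∘ φ.symm) y (b k) *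
        fderiv ℝ (v ∘ φ.symm) y (b l)) := fun v ↦
    integral_mul_gradNorm_eq_integral_chart h b p (N := N) hNpull hNc hw (hwV.trans hVs) v
  have hswap : ∀ {v : X → ℝ} {G : E3 → ℝ}, EqOn (v ∘ φ.symm) G S →
      (fun y ↦ W y * Real.sqrt (∑ l, ∑ k, N y k l * fderiv ℝ (v ∘ φ.symm) y (b k) *
        fderiv ℝ (v ∘ φ.symm) y (b l))) =
      fun y ↦ W y * Real.sqrt (∑ l, ∑ k, N y k l * fderiv ℝ G y (b k) * fderiv ℝ G y (b l)) := by
    intro v G hG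
    funext y
    by_cases hy : y ∈ S
    · rw [(hG.eventuallyEq_of_mem (hSo.mem_nhds hy)).fderiv_eq]
    · rw [hWK y (fun hyK ↦ hy (hK'S hyK)), zero_mul, zero_mul]
  filter_upwards [hmain] with i hi
  rw [hchart U, hchart (u i), hswap hGeq, hswap (hFeq i)]
  exact hi

end ChartLSC

/-! ### Lower semicontinuity of the weighted slope integral, global form -/

section GlobalLSC

variable (h : ContMDiffRiemannianMetric (𝓡 3) ∞ E3 (TangentSpace (𝓡 3) : X → Type _))
  [T2Space X] [LocallyCompactSpace X]

/-- A function which is Lipschitz on a neighbourhood of every point of `Ω` is locally Lipschitz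
on `Ω` (Riemannian distance). [folklore] -/
theorem isLocLipschitzOn_of_forall_exists_nhds {f : X → ℝ} {Ω : Set X}
    (hf : letI : RiemannianBundle (fun x : X ↦ TangentSpace (𝓡 3) x) :=
        ⟨h.toContinuousRiemannianMetric.toRiemannianMetric⟩
      letI : PseudoEMetricSpace X := .ofRiemannianMetric (𝓡 3) X
      ∀ x ∈ Ω, ∃ K : ℝ≥0, ∃ V ∈ 𝓝 x, LipschitzOnWith K f V) :
    IsLocLipschitzOn h f Ω := by
  letI : RiemannianBundle (fun x : X ↦ TangentSpace (𝓡 3) x) :=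
    ⟨h.toContinuousRiemannianMetric.toRiemannianMetric⟩
  letI : PseudoEMetricSpace X := .ofRiemannianMetric (𝓡 3) X
  intro x hx
  obtain ⟨K, V, hV, hK⟩ := hf x hx
  exact ⟨K, V, mem_nhdsWithin_of_mem_nhds hV, hK⟩

variable [MeasurableSpace X] [BorelSpace X] [SecondCountableTopology X]

/-- Integrability of `w |∇u|` for a compactly supported continuous weight `w` supported in an open
set on which `u` is locally Lipschitz. [folklore] -/
theorem integrable_mul_gradNorm {u w : X → ℝ} {Ω : Set X} (hΩ : IsOpen Ω)
    (hu : IsLocLipschitzOn h u Ω) (hw : Continuous w) (hwc : HasCompactSupport w)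
    (hwΩ : tsupport w ⊆ Ω) :
    Integrable (fun x ↦ w x * gradNorm h u x) (riemannianMeasure h) := by
  have h1 := hu.integrableOn_mul_gradNorm h hΩ hwc.isCompact hwΩ hw.continuousOn
  refine (integrableOn_iff_integrable_of_support_subset ?_).1 h1
  intro x hx
  exact subset_tsupport _ (fun hw0 ↦ hx (by simp [hw0]))

set_option backward.isDefEq.respectTransparency false in
/-- **Lower semicontinuity of the weighted slope integral** `u ↦ ∫ w |∇u|_h dμ_h`
**under locally uniform convergence with locally uniform Lipschitz bounds.** Let `Ω` be open,
`uᵢ → U` locally uniformly on `Ω`, and suppose every point of `Ω` has a neighbourhood on which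
all `uᵢ` and `U` are `K`-Lipschitz for the Riemannian distance. Then for every continuous
`w ≥ 0` with compact support in `Ω` and every `ε > 0`, eventually
`∫ w |∇U| dμ_h ≤ ∫ w |∇uᵢ| dμ_h + ε`, i.e. `∫ w|∇U| ≤ liminf ∫ w|∇uᵢ|`. A smooth partition of
unity on `tsupport w` subordinate to chart neighbourhoods
(`SmoothPartitionOfUnity.exists_isSubordinate`) reduces this to the chart-local form
`integral_mul_gradNorm_le_of_tendsto_chart`. This is the lower semicontinuity invoked in
Huisken–Ilmanen's proof of the Compactness Theorem 2.1 ("Since `1 + uᵢ − v` is eventually positive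
and converges uniformly, it follows by lower semicontinuity that `∫ φ|∇u|(1 + u − v) ≤ ∫ φ|∇v|`",
J. Differential Geom. 59 (2001), p. 22); classical source: Giusti 1984, Thm. 1.9.
[cite: HuiskenIlmanenIMCF2001, §2 proof of Thm. 2.1] -/
theorem integral_mul_gradNorm_le_of_tendstoLocallyUniformlyOn {u : ℕ → X → ℝ} {U : X → ℝ}
    {Ω : Set X} (hΩ : IsOpen Ω) (hconv : TendstoLocallyUniformlyOn u U atTop Ω)
    (hlip : letI : RiemannianBundle (fun x : X ↦ TangentSpace (𝓡 3) x) :=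
        ⟨h.toContinuousRiemannianMetric.toRiemannianMetric⟩
      letI : PseudoEMetricSpace X := .ofRiemannianMetric (𝓡 3) X
      ∀ x ∈ Ω, ∃ K : ℝ≥0, ∃ V ∈ 𝓝 x, (∀ i, LipschitzOnWith K (u i) V) ∧ LipschitzOnWith K U V)
    {w : X → ℝ} (hw : Continuous w) (hw0 : ∀ x, 0 ≤ w x) (hwc : HasCompactSupport w)
    (hwΩ : tsupport w ⊆ Ω) {ε : ℝ} (hε : 0 < ε) :
    ∀ᶠ i in atTop, ∫ x, w x * gradNorm h U x ∂riemannianMeasure h ≤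
      (∫ x, w x * gradNorm h (u i) x ∂riemannianMeasure h) + ε := by
  letI : RiemannianBundle (fun x : X ↦ TangentSpace (𝓡 3) x) :=
    ⟨h.toContinuousRiemannianMetric.toRiemannianMetric⟩
  letI : PseudoEMetricSpace X := .ofRiemannianMetric (𝓡 3) X
  -- `U` and the `uᵢ` are locally Lipschitz on `Ω`
  have hUl : IsLocLipschitzOn h U Ω := isLocLipschitzOn_of_forall_exists_nhds h fun x hx ↦ by
    obtain ⟨K, V, hV, -, hK⟩ := hlip x hx; exact ⟨K, V, hV, hK⟩
  have hul : ∀ i, IsLocLipschitzOn h (u i) Ω := fun i ↦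
    isLocLipschitzOn_of_forall_exists_nhds h fun x hx ↦ by
      obtain ⟨K, V, hV, hK, -⟩ := hlip x hx; exact ⟨K, V, hV, hK i⟩
  -- chart data at every point, Lipschitz data at points of `Ω`
  choose Uc hUco hpUc hUcs c hUc using fun x : X ↦ exists_nhds_forall_lipschitzOnWith_chart h x
  choose! K V hV hKu hKU using hlip
  -- an open cover of `tsupport w` by sets on which the chart-local lemma applies
  set T : X → Set X := fun x ↦ interior (V x) ∩ Uc x ∩ Ω ∩ {_y | x ∈ Ω} with hT
  have hTo : ∀ x, IsOpen (T x) := fun x ↦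
    ((isOpen_interior.inter (hUco x)).inter hΩ).inter isOpen_const
  have hcover : tsupport w ⊆ ⋃ x, T x := fun y hy ↦ mem_iUnion.2
    ⟨y, ⟨⟨mem_interior_iff_mem_nhds.2 (hV y (hwΩ hy)), hpUc y⟩, hwΩ hy⟩, hwΩ hy⟩
  obtain ⟨ρ, hρ⟩ := SmoothPartitionOfUnity.exists_isSubordinate (𝓡 3) (isClosed_tsupport w) T
    hTo hcover
  -- finitely many `ρ i` meet `tsupport w`
  have hfin : {i | (support (ρ i) ∩ tsupport w).Nonempty}.Finite :=
    ρ.locallyFinite.finite_nonempty_inter_compact hwc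
  set I₀ := hfin.toFinset with hI₀
  clear_value I₀
  have hsum : ∀ x, w x = ∑ i ∈ I₀, ρ i x * w x := by
    intro x
    by_cases hx : x ∈ tsupport w
    · have h1 : ∑ᶠ i, ρ i x = 1 := ρ.sum_eq_one hx
      have h2 : ∑ᶠ i, ρ i x = ∑ i ∈ I₀, ρ i x := by
        refine finsum_eq_sum_of_support_subset _ fun i hi ↦ ?_
        rw [Finset.mem_coe, hI₀, Set.Finite.mem_toFinset]
        exact ⟨x, hi, hx⟩
      rw [← Finset.sum_mul, ← h2, h1, one_mul]
    · rw [image_eq_zero_of_notMem_tsupport hx]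
      simp only [mul_zero, Finset.sum_const_zero]
  -- each piece `ρ i w` is handled by the chart-local lemma at the point `i`
  have hcpos : 0 < (I₀.card : ℝ) + 1 := Nat.cast_add_one_pos _
  have hε' : 0 < ε / (I₀.card + 1) := div_pos hε hcpos
  have hpiece : ∀ i ∈ I₀, ∀ᶠ n in atTop,
      ∫ x, ρ i x * w x * gradNorm h U x ∂riemannianMeasure h ≤
        (∫ x, ρ i x * w x * gradNorm h (u n) x ∂riemannianMeasure h) + ε / (I₀.card + 1) := by
    intro i hi
    obtain ⟨x, hxρ, -⟩ := (Set.Finite.mem_toFinset hfin).1 (hI₀ ▸ hi)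
    have hxT : x ∈ T i := hρ i (subset_tsupport _ hxρ)
    have hiΩ : i ∈ Ω := hxT.2
    have hV'o : IsOpen (interior (V i) ∩ Uc i ∩ Ω) := (isOpen_interior.inter (hUco i)).inter hΩ
    have hV'U : interior (V i) ∩ Uc i ∩ Ω ⊆ Uc i := fun y hy ↦ hy.1.2
    have hV'V : interior (V i) ∩ Uc i ∩ Ω ⊆ V i := fun y hy ↦ interior_subset hy.1.1
    have hlip' : (∀ n, LipschitzOnWith (K i) (u n) (interior (V i) ∩ Uc i ∩ Ω)) ∧
        LipschitzOnWith (K i) U (interior (V i) ∩ Uc i ∩ Ω) :=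
      ⟨fun n ↦ (hKu i hiΩ n).mono hV'V, (hKU i hiΩ).mono hV'V⟩
    have hconv' : TendstoLocallyUniformlyOn u U atTop (interior (V i) ∩ Uc i ∩ Ω) :=
      hconv.mono fun y hy ↦ hy.2
    have hw' : Continuous fun x ↦ ρ i x * w x := (ρ i).contMDiff.continuous.mul hw
    have hw'0 : ∀ x, 0 ≤ ρ i x * w x := fun x ↦ mul_nonneg (ρ.nonneg i x) (hw0 x)
    have hw'c : HasCompactSupport fun x ↦ ρ i x * w x := hwc.mul_left
    have hw'V : tsupport (fun x ↦ ρ i x * w x) ⊆ interior (V i) ∩ Uc i ∩ Ω :=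
      (tsupport_mul_subset_left (f := (ρ i : X → ℝ)) (g := w)).trans ((hρ i).trans fun y hy ↦ hy.1)
    exact integral_mul_gradNorm_le_of_tendsto_chart h i (hUcs i) (hUc i) hV'o hV'U hlip' hconv'
      hw' hw'0 hw'c hw'V hε'
  -- integrability of the pieces
  have hint : ∀ {v : X → ℝ}, IsLocLipschitzOn h v Ω → ∀ i,
      Integrable (fun x ↦ ρ i x * w x * gradNorm h v x) (riemannianMeasure h) := by
    intro v hv i
    refine integrable_mul_gradNorm h hΩ hv ((ρ i).contMDiff.continuous.mul hw) hwc.mul_left ?_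
    exact (tsupport_mul_subset_right (f := (ρ i : X → ℝ)) (g := w)).trans hwΩ
  have hsplit : ∀ {v : X → ℝ}, IsLocLipschitzOn h v Ω →
      ∫ x, w x * gradNorm h v x ∂riemannianMeasure h =
        ∑ i ∈ I₀, ∫ x, ρ i x * w x * gradNorm h v x ∂riemannianMeasure h := by
    intro v hv
    rw [← integral_finsetSum _ fun i _ ↦ hint hv i]
    refine integral_congr_ae (Eventually.of_forall fun x ↦ ?_)
    simp only
    rw [← Finset.sum_mul, ← hsum x]
  -- conclusion
  have hall := (Finset.eventually_all I₀).2 hpiece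
  filter_upwards [hall] with n hn
  have hcard : (I₀.card : ℝ) * (ε / (I₀.card + 1)) ≤ ε := by
    rw [mul_div_assoc', div_le_iff₀ hcpos]
    nlinarith [hε.le]
  calc ∫ x, w x * gradNorm h U x ∂riemannianMeasure h
      = ∑ i ∈ I₀, ∫ x, ρ i x * w x * gradNorm h U x ∂riemannianMeasure h := hsplit hUl
    _ ≤ ∑ i ∈ I₀, ((∫ x, ρ i x * w x * gradNorm h (u n) x ∂riemannianMeasure h) +
          ε / (I₀.card + 1)) := Finset.sum_le_sum hn
    _ = (∫ x, w x * gradNorm h (u n) x ∂riemannianMeasure h) + I₀.card * (ε / (I₀.card + 1)) := by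
        rw [Finset.sum_add_distrib, Finset.sum_const, nsmul_eq_mul, hsplit (hul n)]
    _ ≤ (∫ x, w x * gradNorm h (u n) x ∂riemannianMeasure h) + ε := by gcongr

end GlobalLSC



end Literature.Geometry.Lorentzian

end
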